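import Summits.ValiantsHypothesis.ValiantsHypothesis.Theorems.LacunarySymmetroidMatrixDescartesPivotTwoDirectionsBlockStraddle

/-!
# `MatrixDescartes` census — the `(2,2)` block with BOTH DIRECTIONS STRADDLING THE PIVOT: `Z₊ ≤ 6` everywhere (nine-nomial form),
# `Z₊ ≤ 4` in the two BALANCED chambers (every size `m + 2`)

HONEST FRAMING.  Object-search cell `pub-symmetroid`, seat `val-sym-mdr-p2` (generation 25); helper file `--supports` the crux item
stmt-ValiantsHypothesis-18050 (`Theses.LacunarySymmetroid.MatrixDescartes`, OPEN, on HOLD) with NO closure claim.  Third sheet on the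
configurations of the BLOCK `(2,2)` QUESTION of `…PivotTwoDirections` (sign-separated: `= 6`, `…BlockLawAll` / `…BlockSix`; one direction
straddling: `≤ 7`, `≤ 5` outside the stuck set and `= 5` attained, `…BlockStraddle` / `…BlockStraddleFive`).  Here BOTH letter pairs straddle
the pivot: `f = c₁X^{p₁} + c₂X^{p₂}`, `p₂ < e < p₁`, on `u`; `g = c₃X^{q₁} + c₄X^{q₂}`, `q₂ < e < q₁`, on `v`; weak hard cell `dJ ≤ 0`,
`mu ≤ 0`, `mv ≤ 0`, `D2 > 0`.  Both END degrees `p₂ + q₂ < … < p₁ + q₁` are pair degrees (positive coefficients), so Descartes on `−Φ` gives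
* `bothStraddle_nineNomial_le_six`: **`Z₊ ≤ 6`** everywhere (the nine-nomial form of `PosEnds.posRoots_add_two_le_of_both_straddle`);
* `bothStraddle_nineNomial_le_four_of_window`: if the closed window between the two CROSS degrees `p₂ + q₁`, `p₁ + q₂` carries no pivot-type
  degree, **`Z₊ ≤ 4`** (`Census.signVariations_window_two_ended` on `−Φ`: two negative degrees outside the window, both ends negative);
* `window_of_balanced` (linear arithmetic) / **`bothStraddle_nineNomial_le_four_of_balanced`**: that happens exactly in the two BALANCED
  chambers `2e < p₁+q₂ < e+q₁ ∧ 2e < p₂+q₁ < e+p₁` and `e+p₂ < p₁+q₂ < 2e ∧ e+q₂ < p₂+q₁ < 2e` (with `α = p₁−e, β = e−p₂, γ = q₁−e,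
  δ = e−q₂`: `δ < α < γ+δ ∧ β < γ < α+β`, or its mirror `α < δ < α+β ∧ γ < β < γ+δ`); elsewhere the Descartes count is `6`;
* block-coefficient and every-size matrix forms (`bothStraddleBlock_anySize_posRoots_le_four_of_balanced`, …) through `…AnySize`.
LOCATED (this seat, exp/hunt6bs.py, exp/shear_bs.py: > 1 000 evolutionary restarts on the number of sign changes of `Φ`): never more
than `4` positive roots in this configuration (the shear zone alone can carry `3`), so the conjectured value is `4` everywhere — «each
straddling direction costs one root»: `6 / 5 / 4`.  Inside the unbalanced chambers `Z₊ ≤ 4` is OPEN (a kill-six problem).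
Nothing here bears on `Theses.LacunarySymmetroid.MatrixDescartes` in its window, on `KPlusLogSqLaw`, on `DoorA26` / `DoorA34`, on the cell's
registers or credences, or on `VP ≠ VNP`.

[folklore] Descartes' rule with the window lemma of the census library; tree lemmas named above.  No definitions, no named facts.
-/

-- `Summit.ValiantsHypothesis.ValiantsHypothesis.…` repeats a component by the D-0017 layout
-- (single-conjunct summit), which the `dupNamespace` linter flags; the name is mandated.
set_option linter.dupNamespace false

namespace Summit.ValiantsHypothesis.ValiantsHypothesis.Theorems.LacunarySymmetroidMatrixDescartes.Pivot.TwoDirections.BlockBothStraddle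

open Polynomial Matrix Finset
open scoped BigOperators

/-! ## 1. Ends of the doubly-straddling nine-nomial -/

/-- In the doubly-straddling order `p₂ < e < p₁`, `q₂ < e < q₁` the nine-nomial has degree `p₁ + q₁` and leading coefficient `c₅`
(position `5`) when that coefficient is non-zero. -/
theorem leadingCoeff_nineNomial_bothStraddle (e p₁ p₂ q₁ q₂ : ℕ) (h2e : p₂ < e) (he1 : e < p₁) (hq2e : q₂ < e) (heq1 : e < q₁)
    (cv : Fin 9 → ℝ) (h5 : cv 5 ≠ 0) : (∑ i : Fin 9, Polynomial.C (cv i) * X ^ ((![2 * e, e + p₁, e + p₂, e + q₁, e + q₂, p₁ + q₁, p₂ + q₁, p₁ + q₂, p₂ + q₂] : Fin 9 → ℕ) i)).leadingCoeff = cv 5 := by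
  have hcoef : (∑ i : Fin 9, Polynomial.C (cv i) * X ^ ((![2 * e, e + p₁, e + p₂, e + q₁, e + q₂, p₁ + q₁, p₂ + q₁, p₁ + q₂, p₂ + q₂] : Fin 9 → ℕ) i)).coeff (p₁ + q₁) = cv 5 := by
    rw [BlockLawAll.coeff_nineNomial, Finset.sum_eq_single (5 : Fin 9)]
    · simp
    · intro i _ hi
      fin_cases i <;> simp at hi ⊢ <;> omega
    · simp
  have hle : (∑ i : Fin 9, Polynomial.C (cv i) * X ^ ((![2 * e, e + p₁, e + p₂, e + q₁, e + q₂, p₁ + q₁, p₂ + q₁, p₁ + q₂, p₂ + q₂] : Fin 9 → ℕ) i)).natDegree ≤ p₁ + q₁ := by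
    refine natDegree_sum_le_of_forall_le _ _ fun i _ => (natDegree_C_mul_X_pow_le _ _).trans ?_
    fin_cases i <;> simp <;> omega
  have hdeg : (∑ i : Fin 9, Polynomial.C (cv i) * X ^ ((![2 * e, e + p₁, e + p₂, e + q₁, e + q₂, p₁ + q₁, p₂ + q₁, p₁ + q₂, p₂ + q₂] : Fin 9 → ℕ) i)).natDegree = p₁ + q₁ := natDegree_eq_of_le_of_coeff_ne_zero hle (by rw [hcoef]; exact h5)
  change (∑ i : Fin 9, Polynomial.C (cv i) * X ^ ((![2 * e, e + p₁, e + p₂, e + q₁, e + q₂, p₁ + q₁, p₂ + q₁, p₁ + q₂, p₂ + q₂] : Fin 9 → ℕ) i)).coeff (∑ i : Fin 9, Polynomial.C (cv i) * X ^ ((![2 * e, e + p₁, e + p₂, e + q₁, e + q₂, p₁ + q₁, p₂ + q₁, p₁ + q₂, p₂ + q₂] : Fin 9 → ℕ) i)).natDegree = cv 5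
  rw [hdeg, hcoef]

/-- In the doubly-straddling order the nine-nomial has trailing degree `p₂ + q₂` and trailing coefficient `c₈` (position `8`) when that
coefficient is non-zero. -/
theorem trailingCoeff_nineNomial_bothStraddle (e p₁ p₂ q₁ q₂ : ℕ) (h2e : p₂ < e) (he1 : e < p₁) (hq2e : q₂ < e) (heq1 : e < q₁)
    (cv : Fin 9 → ℝ) (h8 : cv 8 ≠ 0) : (∑ i : Fin 9, Polynomial.C (cv i) * X ^ ((![2 * e, e + p₁, e + p₂, e + q₁, e + q₂, p₁ + q₁, p₂ + q₁, p₁ + q₂, p₂ + q₂] : Fin 9 → ℕ) i)).trailingCoeff = cv 8 := by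
  have hcoef : (∑ i : Fin 9, Polynomial.C (cv i) * X ^ ((![2 * e, e + p₁, e + p₂, e + q₁, e + q₂, p₁ + q₁, p₂ + q₁, p₁ + q₂, p₂ + q₂] : Fin 9 → ℕ) i)).coeff (p₂ + q₂) = cv 8 := by
    rw [BlockLawAll.coeff_nineNomial, Finset.sum_eq_single (8 : Fin 9)]
    · simp
    · intro i _ hi
      fin_cases i <;> simp at hi ⊢ <;> omega
    · simp
  have hne : (∑ i : Fin 9, Polynomial.C (cv i) * X ^ ((![2 * e, e + p₁, e + p₂, e + q₁, e + q₂, p₁ + q₁, p₂ + q₁, p₁ + q₂, p₂ + q₂] : Fin 9 → ℕ) i)) ≠ 0 := fun h0 => by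
    have := hcoef; rw [h0, coeff_zero] at this; exact h8 this.symm
  have hge : p₂ + q₂ ≤ (∑ i : Fin 9, Polynomial.C (cv i) * X ^ ((![2 * e, e + p₁, e + p₂, e + q₁, e + q₂, p₁ + q₁, p₂ + q₁, p₁ + q₂, p₂ + q₂] : Fin 9 → ℕ) i)).natTrailingDegree := by
    refine le_natTrailingDegree hne fun m hm => ?_
    rw [BlockLawAll.coeff_nineNomial]
    refine Finset.sum_eq_zero fun i _ => ?_
    rw [if_neg]
    fin_cases i <;> simp <;> omega
  have hle : (∑ i : Fin 9, Polynomial.C (cv i) * X ^ ((![2 * e, e + p₁, e + p₂, e + q₁, e + q₂, p₁ + q₁, p₂ + q₁, p₁ + q₂, p₂ + q₂] : Fin 9 → ℕ) i)).natTrailingDegree ≤ p₂ + q₂ := natTrailingDegree_le_of_ne_zero (by rw [hcoef]; exact h8)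
  change (∑ i : Fin 9, Polynomial.C (cv i) * X ^ ((![2 * e, e + p₁, e + p₂, e + q₁, e + q₂, p₁ + q₁, p₂ + q₁, p₁ + q₂, p₂ + q₂] : Fin 9 → ℕ) i)).coeff (∑ i : Fin 9, Polynomial.C (cv i) * X ^ ((![2 * e, e + p₁, e + p₂, e + q₁, e + q₂, p₁ + q₁, p₂ + q₁, p₁ + q₂, p₂ + q₂] : Fin 9 → ℕ) i)).natTrailingDegree = cv 8
  rw [le_antisymm hle hge, hcoef]

/-! ## 2. `Z₊ ≤ 6` everywhere; `Z₊ ≤ 4` when the window between the cross degrees is pivot-free -/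

/-- **`Z₊ ≤ 6` FOR THE DOUBLY-STRADDLING NINE-NOMIAL** (pivot-type coefficients `≤ 0`, end pair coefficients `c₅, c₈ > 0`): both ends of `−Φ`
are negative and its negative coefficients occupy at most the four pair degrees, so `Var + 2 ≤ 8`. [this file] -/
theorem bothStraddle_nineNomial_le_six (e p₁ p₂ q₁ q₂ : ℕ) (h2e : p₂ < e) (he1 : e < p₁) (hq2e : q₂ < e) (heq1 : e < q₁)
    (cv : Fin 9 → ℝ) (hnp : ∀ i : Fin 9, (i : ℕ) < 5 → cv i ≤ 0) (h5 : 0 < cv 5) (h8 : 0 < cv 8) :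
    ((∑ i : Fin 9, Polynomial.C (cv i) * X ^ ((![2 * e, e + p₁, e + p₂, e + q₁, e + q₂, p₁ + q₁, p₂ + q₁, p₁ + q₂, p₂ + q₂] : Fin 9 → ℕ) i)).roots.toFinset.filter (fun t => 0 < t)).card ≤ 6 := by
  classical
  set f := (∑ i : Fin 9, Polynomial.C (cv i) * X ^ ((![2 * e, e + p₁, e + p₂, e + q₁, e + q₂, p₁ + q₁, p₂ + q₁, p₁ + q₂, p₂ + q₂] : Fin 9 → ℕ) i)) with hf
  have hlead : (-f).leadingCoeff < 0 := by
    rw [leadingCoeff_neg, hf, leadingCoeff_nineNomial_bothStraddle e p₁ p₂ q₁ q₂ h2e he1 hq2e heq1 cv h5.ne']; linarith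
  have htrail : (-f).trailingCoeff < 0 := by
    rw [PosEnds.trailingCoeff_neg', hf, trailingCoeff_nineNomial_bothStraddle e p₁ p₂ q₁ q₂ h2e he1 hq2e heq1 cv h8.ne']; linarith
  have hsub : TwoDescartes.negSupp (-f) ⊆ ({p₁ + q₁, p₂ + q₁, p₁ + q₂, p₂ + q₂} : Finset ℕ) := by
    intro n hn
    simp only [TwoDescartes.negSupp, Finset.mem_filter] at hn
    exact BlockStraddle.mem_pairDegrees_of_coeff_neg_neg e p₁ p₂ q₁ q₂ cv hnp n hn.2
  have hbudget := Census.signVariations_two_ended_le (-f)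
  rw [if_pos hlead, if_pos htrail, signVariations_neg] at hbudget
  have hc := (Finset.card_le_card hsub).trans (Finset.card_le_four : ({p₁ + q₁, p₂ + q₁, p₁ + q₂, p₂ + q₂} : Finset ℕ).card ≤ 4)
  refine (WLawTwoChambers.card_posRoots_le_signVariations f).trans ?_
  omega

/-- **PIVOT-FREE CROSS WINDOW ⇒ `Z₊ ≤ 4`.**  If no pivot-type degree lies in the closed window between the cross degrees `p₂ + q₁` and
`p₁ + q₂` (any `u ≤ v` enclosing both), the coefficients of `−Φ` on `[u, v]` are `≤ 0` and its negative coefficients outside the window sit at the two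
end degrees, so the window lemma gives `Var + 2 ≤ 2·2 + 2`. [this file] -/
theorem bothStraddle_nineNomial_le_four_of_window (e p₁ p₂ q₁ q₂ : ℕ) (h2e : p₂ < e) (he1 : e < p₁) (hq2e : q₂ < e) (heq1 : e < q₁)
    (cv : Fin 9 → ℝ) (hnp : ∀ i : Fin 9, (i : ℕ) < 5 → cv i ≤ 0) (hpp : ∀ i : Fin 9, 5 ≤ (i : ℕ) → 0 ≤ cv i) (h5 : 0 < cv 5)
    (h8 : 0 < cv 8) (u v : ℕ) (huv : u ≤ v) (hlo : u ≤ p₂ + q₁ ∧ u ≤ p₁ + q₂) (hhi : p₂ + q₁ ≤ v ∧ p₁ + q₂ ≤ v)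
    (hwin : ∀ i : Fin 9, (i : ℕ) < 5 → (![2 * e, e + p₁, e + p₂, e + q₁, e + q₂, p₁ + q₁, p₂ + q₁, p₁ + q₂, p₂ + q₂] : Fin 9 → ℕ) i < u
      ∨ v < (![2 * e, e + p₁, e + p₂, e + q₁, e + q₂, p₁ + q₁, p₂ + q₁, p₁ + q₂, p₂ + q₂] : Fin 9 → ℕ) i) :
    ((∑ i : Fin 9, Polynomial.C (cv i) * X ^ ((![2 * e, e + p₁, e + p₂, e + q₁, e + q₂, p₁ + q₁, p₂ + q₁, p₁ + q₂, p₂ + q₂] : Fin 9 → ℕ) i)).roots.toFinset.filter (fun t => 0 < t)).card ≤ 4 := by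
  classical
  set f := (∑ i : Fin 9, Polynomial.C (cv i) * X ^ ((![2 * e, e + p₁, e + p₂, e + q₁, e + q₂, p₁ + q₁, p₂ + q₁, p₁ + q₂, p₂ + q₂] : Fin 9 → ℕ) i)) with hf
  have hlead : (-f).leadingCoeff < 0 := by
    rw [leadingCoeff_neg, hf, leadingCoeff_nineNomial_bothStraddle e p₁ p₂ q₁ q₂ h2e he1 hq2e heq1 cv h5.ne']; linarith
  have htrail : (-f).trailingCoeff < 0 := by
    rw [PosEnds.trailingCoeff_neg', hf, trailingCoeff_nineNomial_bothStraddle e p₁ p₂ q₁ q₂ h2e he1 hq2e heq1 cv h8.ne']; linarith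
  -- coefficients of `−f` on the window are `≤ 0`: only pair positions can sit there
  have hwin' : ∀ m, u ≤ m → m ≤ v → (-f).coeff m ≤ 0 := by
    intro m hum hmv
    rw [coeff_neg, neg_nonpos, hf, BlockLawAll.coeff_nineNomial]
    refine Finset.sum_nonneg fun i _ => ?_
    split_ifs with hmi
    · by_cases hi : (i : ℕ) < 5
      · rcases hwin i hi with h | h
        · rw [← hmi] at h; omega
        · rw [← hmi] at h; omega
      · exact hpp i (by omega)
    · exact le_rfl
  -- negative coefficients of `−f` outside the window sit at the two end pair degrees
  have hT : ∀ m, (-f).coeff m < 0 → (m < u ∨ v < m) → m ∈ ({p₁ + q₁, p₂ + q₂} : Finset ℕ) := by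
    intro m hm hout
    have h := BlockStraddle.mem_pairDegrees_of_coeff_neg_neg e p₁ p₂ q₁ q₂ cv hnp m hm
    simp only [Finset.mem_insert, Finset.mem_singleton] at h ⊢
    omega
  have hw := Census.signVariations_window_two_ended (-f) u v huv hwin' {p₁ + q₁, p₂ + q₂} hT
  rw [if_pos hlead, if_pos htrail, signVariations_neg] at hw
  have hc : ({p₁ + q₁, p₂ + q₂} : Finset ℕ).card ≤ 2 := Finset.card_le_two
  refine (WLawTwoChambers.card_posRoots_le_signVariations f).trans ?_
  omega

/-! ## 3. The balanced chambers -/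

/-- **In the two balanced chambers the cross window is pivot-free** (and only there: the bottom gap always carries `e + p₂`, the top gap
`e + p₁` or `e + q₁`, and a window straddling `2e` carries the pivot degree). [linear arithmetic] -/
theorem window_of_balanced (e p₁ p₂ q₁ q₂ : ℕ) (h2e : p₂ < e) (he1 : e < p₁) (hq2e : q₂ < e) (heq1 : e < q₁)
    (hbal : (2 * e < p₁ + q₂ ∧ p₁ + q₂ < e + q₁ ∧ 2 * e < p₂ + q₁ ∧ p₂ + q₁ < e + p₁)
      ∨ (e + p₂ < p₁ + q₂ ∧ p₁ + q₂ < 2 * e ∧ e + q₂ < p₂ + q₁ ∧ p₂ + q₁ < 2 * e)) :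
    ∀ i : Fin 9, (i : ℕ) < 5 → (![2 * e, e + p₁, e + p₂, e + q₁, e + q₂, p₁ + q₁, p₂ + q₁, p₁ + q₂, p₂ + q₂] : Fin 9 → ℕ) i < min (p₂ + q₁) (p₁ + q₂)
      ∨ max (p₂ + q₁) (p₁ + q₂) < (![2 * e, e + p₁, e + p₂, e + q₁, e + q₂, p₁ + q₁, p₂ + q₁, p₁ + q₂, p₂ + q₂] : Fin 9 → ℕ) i := by
  intro i hi
  fin_cases i <;> simp at hi ⊢ <;> omega

/-- **`Z₊ ≤ 4` IN THE BALANCED CHAMBERS** (real-parameter form). [this file] -/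
theorem bothStraddle_nineNomial_le_four_of_balanced (e p₁ p₂ q₁ q₂ : ℕ) (h2e : p₂ < e) (he1 : e < p₁) (hq2e : q₂ < e) (heq1 : e < q₁)
    (hbal : (2 * e < p₁ + q₂ ∧ p₁ + q₂ < e + q₁ ∧ 2 * e < p₂ + q₁ ∧ p₂ + q₁ < e + p₁)
      ∨ (e + p₂ < p₁ + q₂ ∧ p₁ + q₂ < 2 * e ∧ e + q₂ < p₂ + q₁ ∧ p₂ + q₁ < 2 * e))
    (cv : Fin 9 → ℝ) (hnp : ∀ i : Fin 9, (i : ℕ) < 5 → cv i ≤ 0) (hpp : ∀ i : Fin 9, 5 ≤ (i : ℕ) → 0 ≤ cv i) (h5 : 0 < cv 5)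
    (h8 : 0 < cv 8) :
    ((∑ i : Fin 9, Polynomial.C (cv i) * X ^ ((![2 * e, e + p₁, e + p₂, e + q₁, e + q₂, p₁ + q₁, p₂ + q₁, p₁ + q₂, p₂ + q₂] : Fin 9 → ℕ) i)).roots.toFinset.filter (fun t => 0 < t)).card ≤ 4 :=
  bothStraddle_nineNomial_le_four_of_window e p₁ p₂ q₁ q₂ h2e he1 hq2e heq1 cv hnp hpp h5 h8 (min (p₂ + q₁) (p₁ + q₂))
    (max (p₂ + q₁) (p₁ + q₂)) min_le_max ⟨min_le_left _ _, min_le_right _ _⟩ ⟨le_max_left _ _, le_max_right _ _⟩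
    (window_of_balanced e p₁ p₂ q₁ q₂ h2e he1 hq2e heq1 hbal)

/-! ## 4. Block coefficients and the matrix forms at every size -/

/-- **THE DOUBLY-STRADDLING `(2,2)` BLOCK: `Z₊ ≤ 6`** (`cᵢ > 0`, `dJ ≤ 0`, `mu ≤ 0`, `mv ≤ 0`, `D2 > 0`; nine-nomial form of
`PosEnds.posRoots_add_two_le_of_both_straddle`). [this file] -/
theorem bothStraddleBlock_nineNomial_le_six (e p₁ p₂ q₁ q₂ : ℕ) (h2e : p₂ < e) (he1 : e < p₁) (hq2e : q₂ < e) (heq1 : e < q₁)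
    (dJ mu mv Δ2 c₁ c₂ c₃ c₄ : ℝ) (hc₁ : 0 < c₁) (hc₂ : 0 < c₂) (hc₃ : 0 < c₃) (hc₄ : 0 < c₄) (hdJ : dJ ≤ 0) (hmu : mu ≤ 0) (hmv : mv ≤ 0)
    (hΔ2p : 0 < Δ2) :
    ((∑ i : Fin 9, Polynomial.C ((![dJ, c₁ * mu, c₂ * mu, c₃ * mv, c₄ * mv, c₁ * c₃ * Δ2, c₂ * c₃ * Δ2, c₁ * c₄ * Δ2, c₂ * c₄ * Δ2] : Fin 9 → ℝ) i) * X ^ ((![2 * e, e + p₁, e + p₂, e + q₁, e + q₂, p₁ + q₁, p₂ + q₁, p₁ + q₂, p₂ + q₂] : Fin 9 → ℕ) i)).roots.toFinset.filter (fun t => 0 < t)).card ≤ 6 := by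
  have hm₁ : c₁ * mu ≤ 0 := mul_nonpos_of_nonneg_of_nonpos hc₁.le hmu
  have hm₂ : c₂ * mu ≤ 0 := mul_nonpos_of_nonneg_of_nonpos hc₂.le hmu
  have hm₃ : c₃ * mv ≤ 0 := mul_nonpos_of_nonneg_of_nonpos hc₃.le hmv
  have hm₄ : c₄ * mv ≤ 0 := mul_nonpos_of_nonneg_of_nonpos hc₄.le hmv
  refine bothStraddle_nineNomial_le_six e p₁ p₂ q₁ q₂ h2e he1 hq2e heq1 _ (fun i hi => ?_) ?_ ?_
  · fin_cases i <;> simp at hi ⊢ <;> assumption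
  · simp only [Fin.isValue, Matrix.cons_val]; positivity
  · simp only [Fin.isValue, Matrix.cons_val]; positivity

/-- **THE DOUBLY-STRADDLING `(2,2)` BLOCK IN THE BALANCED CHAMBERS: `Z₊ ≤ 4`.** [this file] -/
theorem bothStraddleBlock_nineNomial_le_four_of_balanced (e p₁ p₂ q₁ q₂ : ℕ) (h2e : p₂ < e) (he1 : e < p₁) (hq2e : q₂ < e)
    (heq1 : e < q₁)
    (hbal : (2 * e < p₁ + q₂ ∧ p₁ + q₂ < e + q₁ ∧ 2 * e < p₂ + q₁ ∧ p₂ + q₁ < e + p₁)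
      ∨ (e + p₂ < p₁ + q₂ ∧ p₁ + q₂ < 2 * e ∧ e + q₂ < p₂ + q₁ ∧ p₂ + q₁ < 2 * e))
    (dJ mu mv Δ2 c₁ c₂ c₃ c₄ : ℝ) (hc₁ : 0 < c₁) (hc₂ : 0 < c₂) (hc₃ : 0 < c₃) (hc₄ : 0 < c₄) (hdJ : dJ ≤ 0) (hmu : mu ≤ 0) (hmv : mv ≤ 0)
    (hΔ2p : 0 < Δ2) :
    ((∑ i : Fin 9, Polynomial.C ((![dJ, c₁ * mu, c₂ * mu, c₃ * mv, c₄ * mv, c₁ * c₃ * Δ2, c₂ * c₃ * Δ2, c₁ * c₄ * Δ2, c₂ * c₄ * Δ2] : Fin 9 → ℝ) i) * X ^ ((![2 * e, e + p₁, e + p₂, e + q₁, e + q₂, p₁ + q₁, p₂ + q₁, p₁ + q₂, p₂ + q₂] : Fin 9 → ℕ) i)).roots.toFinset.filter (fun t => 0 < t)).card ≤ 4 := by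
  have hm₁ : c₁ * mu ≤ 0 := mul_nonpos_of_nonneg_of_nonpos hc₁.le hmu
  have hm₂ : c₂ * mu ≤ 0 := mul_nonpos_of_nonneg_of_nonpos hc₂.le hmu
  have hm₃ : c₃ * mv ≤ 0 := mul_nonpos_of_nonneg_of_nonpos hc₃.le hmv
  have hm₄ : c₄ * mv ≤ 0 := mul_nonpos_of_nonneg_of_nonpos hc₄.le hmv
  refine bothStraddle_nineNomial_le_four_of_balanced e p₁ p₂ q₁ q₂ h2e he1 hq2e heq1 hbal _ (fun i hi => ?_) (fun i hi => ?_) ?_ ?_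
  · fin_cases i <;> simp at hi ⊢ <;> assumption
  · fin_cases i <;> simp at hi ⊢ <;> positivity
  · simp only [Fin.isValue, Matrix.cons_val]; positivity
  · simp only [Fin.isValue, Matrix.cons_val]; positivity

variable {m : ℕ}

/-- **MATRIX FORM AT EVERY SIZE `m + 2`: `Z₊ ≤ 6`** for `F = X^e J + (c₁X^{p₁} + c₂X^{p₂}) uuᵀ + (c₃X^{q₁} + c₄X^{q₂}) vvᵀ` with both letter
pairs straddling the pivot (`p₂ < e < p₁`, `q₂ < e < q₁`), `cᵢ > 0`, size-`m + 2` weak hard cell. [this file + `…AnySize`] -/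
theorem bothStraddleBlock_anySize_posRoots_le_six (e p₁ p₂ q₁ q₂ : ℕ) (h2e : p₂ < e) (he1 : e < p₁) (hq2e : q₂ < e) (heq1 : e < q₁)
    (J : Matrix (Fin (m + 2)) (Fin (m + 2)) ℝ) (hJ : J.det < 0) (u v : Fin (m + 2) → ℝ) (c₁ c₂ c₃ c₄ : ℝ)
    (hc₁ : 0 < c₁) (hc₂ : 0 < c₂) (hc₃ : 0 < c₃) (hc₄ : 0 < c₄)
    (hmu : J.det * (u ⬝ᵥ J⁻¹ *ᵥ u) ≤ 0) (hmv : J.det * (v ⬝ᵥ J⁻¹ *ᵥ v) ≤ 0)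
    (hD2 : 0 < J.det * ((u ⬝ᵥ J⁻¹ *ᵥ u) * (v ⬝ᵥ J⁻¹ *ᵥ v) - (u ⬝ᵥ J⁻¹ *ᵥ v) * (v ⬝ᵥ J⁻¹ *ᵥ u))) :
    ((Matrix.det (((X : ℝ[X]) ^ e) • J.map Polynomial.C
        + (Polynomial.C c₁ * X ^ p₁ + Polynomial.C c₂ * X ^ p₂) • (vecMulVec u u).map Polynomial.C
        + (Polynomial.C c₃ * X ^ q₁ + Polynomial.C c₄ * X ^ q₂) • (vecMulVec v v).map Polynomial.C)).roots.toFinset.filter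
        (fun t => 0 < t)).card ≤ 6 := by
  rw [AnySize.posRoots_twoDir_anySize_eq e J hJ.ne u v _ _, AnySize.Φ_block22_eq_nineNomial]
  exact bothStraddleBlock_nineNomial_le_six e p₁ p₂ q₁ q₂ h2e he1 hq2e heq1 _ _ _ _ c₁ c₂ c₃ c₄ hc₁ hc₂ hc₃ hc₄ hJ.le hmu hmv hD2

/-- **MATRIX FORM AT EVERY SIZE `m + 2`: `Z₊ ≤ 4` IN THE BALANCED CHAMBERS.** [this file + `…AnySize`] -/
theorem bothStraddleBlock_anySize_posRoots_le_four_of_balanced (e p₁ p₂ q₁ q₂ : ℕ) (h2e : p₂ < e) (he1 : e < p₁) (hq2e : q₂ < e)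
    (heq1 : e < q₁)
    (hbal : (2 * e < p₁ + q₂ ∧ p₁ + q₂ < e + q₁ ∧ 2 * e < p₂ + q₁ ∧ p₂ + q₁ < e + p₁)
      ∨ (e + p₂ < p₁ + q₂ ∧ p₁ + q₂ < 2 * e ∧ e + q₂ < p₂ + q₁ ∧ p₂ + q₁ < 2 * e))
    (J : Matrix (Fin (m + 2)) (Fin (m + 2)) ℝ) (hJ : J.det < 0) (u v : Fin (m + 2) → ℝ) (c₁ c₂ c₃ c₄ : ℝ)
    (hc₁ : 0 < c₁) (hc₂ : 0 < c₂) (hc₃ : 0 < c₃) (hc₄ : 0 < c₄)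
    (hmu : J.det * (u ⬝ᵥ J⁻¹ *ᵥ u) ≤ 0) (hmv : J.det * (v ⬝ᵥ J⁻¹ *ᵥ v) ≤ 0)
    (hD2 : 0 < J.det * ((u ⬝ᵥ J⁻¹ *ᵥ u) * (v ⬝ᵥ J⁻¹ *ᵥ v) - (u ⬝ᵥ J⁻¹ *ᵥ v) * (v ⬝ᵥ J⁻¹ *ᵥ u))) :
    ((Matrix.det (((X : ℝ[X]) ^ e) • J.map Polynomial.C
        + (Polynomial.C c₁ * X ^ p₁ + Polynomial.C c₂ * X ^ p₂) • (vecMulVec u u).map Polynomial.C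
        + (Polynomial.C c₃ * X ^ q₁ + Polynomial.C c₄ * X ^ q₂) • (vecMulVec v v).map Polynomial.C)).roots.toFinset.filter
        (fun t => 0 < t)).card ≤ 4 := by
  rw [AnySize.posRoots_twoDir_anySize_eq e J hJ.ne u v _ _, AnySize.Φ_block22_eq_nineNomial]
  exact bothStraddleBlock_nineNomial_le_four_of_balanced e p₁ p₂ q₁ q₂ h2e he1 hq2e heq1 hbal _ _ _ _ c₁ c₂ c₃ c₄ hc₁ hc₂ hc₃ hc₄
    hJ.le hmu hmv hD2

end Summit.ValiantsHypothesis.ValiantsHypothesis.Theorems.LacunarySymmetroidMatrixDescartes.Pivot.TwoDirections.BlockBothStraddle
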